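import Summits.ABC.IUTFork.Cor312LicenceTripleHullCellRefuteTame
import Summits.ABC.IUTFork.Repair.RHHullThresholdExact
import Summits.ABC.IUTFork.Conditional.AbcOfSGenuineKLinUniformRows4
import HarnessLib

/-!
# R-W «W:REF-BANDS-EXACT», exact-cell LEVELS addendum: the triple `11 * 103 ^ 8 + 2 ^ 45 * 3 ^ 7 * 29 * 37 * 1997 = 5 ^ 11 * 7 ^ 10 * 79 * 389 ^ 2` — S_H REFUTED at the primes `l ∈ {7429343, 7429363, 7429379, 7429421, 7429439, 7429441, 7429451, 7429463, 7429469}`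
# (beyond the floor-free band) by the top-label cell with its EXACT floor, NO local-type hypothesis (pole `p = 103`, class `{15}`)

PROOF-ONLY file (D-0012: 0 definitions, 0 `Prop` facts, no instance, no notation) of the abc-iut cell — D-0079 RESCUE sub-cell R-W «WINDOW Θ-SIDE
INEQUALITY», numerics-crew seat abc-iut-W-num-6 (gen 4), row «W:REF-BANDS-EXACT» (abc-iut-plan g11 C-R84 (b) / C-R88 (a)); GENERATED by
HOME/abc-iut-W-num-6/refbands/emit_levels.py. It complements this seat's band file `Conditional/RefBandsExact139344708952637771.lean` (the floor-free LINEAR certificate,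
uniform in `l`): at the listed primes the floor-free margin is `≤ 0` but R-H row 4's closed-form cell `HullCell (A·l) (A·v) l⋆ (⌊A·l/(p−1)⌋+1) (p^{a₀} − a₀·A·l)`
with its EXACT integer floor still FAILS for every class member (closed integer evaluations, `norm_num`); these are exactly the primes of the residual window
of HOME/abc-iut-W-num-6/refbands/UND-AT-PRIMES.tsv at which the exact top-label cell decides (the R-W numerics lead's floor-free INHABITED certificate starts
just above). ENGINE (BY NAME): abc-iut-W-neg-1 g4's `GenuineK.not_pilotKummerCompatHull_chosen_triple_of_hullCells_tame`. TAKES NO SIDE on [IUTchIII] Cor. 3.12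
(S. Mochizuki, *Inter-universal Teichmüller theory III*, Cor. 3.12 p. 173–174, Step (xi-f) p. 184) or on any author. HONEST SCOPE as in the band file: SHARP reading;
per-label licence STRONGER than print; admissibility / Szpiro-badness / (P6) and non-emptiness of the datum type NOT claimed; «refuted as typed» ≠ «refuted
in print»; typed ≠ proved; no abc claim. [cite: Mochizuki2012, IUTchIII Cor. 3.12 Step (xi-f) p. 184; IUTchIV Thm. 1.10 p. 22, Cor. 2.2 (ii) proof (P5) p. 46]
[cite: DupuyHilado2025, §3.4, §4.9, §4.12] [claim: Mochizuki2012, status: disputed] for every IUT sentence quoted. Axioms: standard.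
-/

noncomputable section

open Set Function NumberField IsDedekindDomain

namespace Summit.ABC.IUTFork.Conditional

open Thm311 Thm311.Real Cor312 Cor312Vol Cor312Prov Literature.IUT.LogThetaLattice Literature.IUT.LogVolume
  Literature.IUT.HodgeTheaters Literature.IUT.LogVolume.ThetaData Literature.IUT.LogVolume.Cor22
open Literature.NumberTheory.NumberFields Literature.NumberTheory.GaloisRepresentations.Ultrametric
open Literature.NumberTheory.DiophantineGeometry Literature.NumberTheory.DiophantineGeometry.GenEll Summit.ABC.ABC.Theorems
open Summit.ABC.IUTFork.Repair.RH.HullThresholdExact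

/-- **The engine's `hcell` at the exact levels `l ∈ {7429343, 7429363, 7429379, 7429421, 7429439, 7429441, 7429451, 7429463, 7429469}` (pole `p = 103`, `v = 8`, top label): for every class member the top-label cell with
its exact floor FAILS — closed integer evaluations.** [folklore] -/
theorem RefBand.cells_139344708952637771_levels {l : ℕ} (hl : l ∈ [7429343, 7429363, 7429379, 7429421, 7429439, 7429441, 7429451, 7429463, 7429469]) {i : ℕ} (hi : i + 1 = (l - 1) / 2)
    (A : ℕ) (hA30 : A ∣ 30) (hA15 : 15 ∣ A * 8) (hAev : Even 8 → A ∣ 15) :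
    ∃ a₀ : ℕ, (∀ s : ℕ, s < a₀ → (1 : ℤ) * ((103 : ℕ) : ℤ) ^ s * (((103 : ℕ) : ℤ) - 1) < ((A * l : ℕ) : ℤ)) ∧
      ((A * l : ℕ) : ℤ) ≤ 1 * ((103 : ℕ) : ℤ) ^ a₀ * (((103 : ℕ) : ℤ) - 1) ∧
      ¬ HullCell ((A * l : ℕ) : ℤ) ((A * 8 : ℕ) : ℤ) ((i : ℤ) + 1) (((A * l) / ((103 : ℕ) - 1) + 1 : ℕ) : ℤ)
        (((103 : ℕ) : ℤ) ^ a₀ - (a₀ : ℤ) * ((A * l : ℕ) : ℤ)) := by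
  have hA : A = 15 := by
    have hA31 : A ≤ 30 := Nat.le_of_dvd (by norm_num) hA30
    interval_cases A <;> first | decide | omega | exact absurd (hAev ⟨4, by norm_num⟩) (by decide)
  simp only [List.mem_cons, List.not_mem_nil, or_false] at hl
  obtain rfl := hA
  rcases hl with rfl | rfl | rfl | rfl | rfl | rfl | rfl | rfl | rfl
  · -- A = 15, l = 7429343: a₀ = 3
    obtain rfl : i = 3714670 := by omega
    refine ⟨3, fun s hs => ?_, by norm_num, ?_⟩
    · interval_cases s <;> norm_num
    · unfold HullCell; norm_num
  · -- A = 15, l = 7429363: a₀ = 3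
    obtain rfl : i = 3714680 := by omega
    refine ⟨3, fun s hs => ?_, by norm_num, ?_⟩
    · interval_cases s <;> norm_num
    · unfold HullCell; norm_num
  · -- A = 15, l = 7429379: a₀ = 3
    obtain rfl : i = 3714688 := by omega
    refine ⟨3, fun s hs => ?_, by norm_num, ?_⟩
    · interval_cases s <;> norm_num
    · unfold HullCell; norm_num
  · -- A = 15, l = 7429421: a₀ = 3
    obtain rfl : i = 3714709 := by omega
    refine ⟨3, fun s hs => ?_, by norm_num, ?_⟩
    · interval_cases s <;> norm_num
    · unfold HullCell; norm_num
  · -- A = 15, l = 7429439: a₀ = 3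
    obtain rfl : i = 3714718 := by omega
    refine ⟨3, fun s hs => ?_, by norm_num, ?_⟩
    · interval_cases s <;> norm_num
    · unfold HullCell; norm_num
  · -- A = 15, l = 7429441: a₀ = 3
    obtain rfl : i = 3714719 := by omega
    refine ⟨3, fun s hs => ?_, by norm_num, ?_⟩
    · interval_cases s <;> norm_num
    · unfold HullCell; norm_num
  · -- A = 15, l = 7429451: a₀ = 3
    obtain rfl : i = 3714724 := by omega
    refine ⟨3, fun s hs => ?_, by norm_num, ?_⟩
    · interval_cases s <;> norm_num
    · unfold HullCell; norm_num
  · -- A = 15, l = 7429463: a₀ = 3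
    obtain rfl : i = 3714730 := by omega
    refine ⟨3, fun s hs => ?_, by norm_num, ?_⟩
    · interval_cases s <;> norm_num
    · unfold HullCell; norm_num
  · -- A = 15, l = 7429469: a₀ = 3
    obtain rfl : i = 3714733 := by omega
    refine ⟨3, fun s hs => ?_, by norm_num, ?_⟩
    · interval_cases s <;> norm_num
    · unfold HullCell; norm_num

/-- **R-W «W:REF-BANDS-EXACT», levels — the triple `11 * 103 ^ 8 + 2 ^ 45 * 3 ^ 7 * 29 * 37 * 1997 = 5 ^ 11 * 7 ^ 10 * 79 * 389 ^ 2` REFUTED (S_H level) at the primes `l ∈ {7429343, 7429363, 7429379, 7429421, 7429439, 7429441, 7429451, 7429463, 7429469}`, UNCONDITIONALLY:**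
EVERY genuine Θ-volume datum `T` over `(ratPoint (a/c), l)`, chosen realising ideles, pinned reading, every free binder; abc-iut-W-neg-1's engine at
`p = 103` with `RefBand.cells_139344708952637771_levels`. [cite: Mochizuki2012, IUTchIII Cor. 3.12 Step (xi-f) p. 184; IUTchIV Cor. 2.2 (ii) proof (P5) p. 46]
[claim: Mochizuki2012, status: disputed] -/
theorem GenuineK.not_pilotKummerCompatHull_chosen_triple_139344708952637771_levels {l : ℕ} (hl : l ∈ [7429343, 7429363, 7429379, 7429421, 7429439, 7429441, 7429451, 7429463, 7429469])
    (T : Cor22.ThetaVolumeDatumAt (ratPoint (((11 * 103 ^ 8 : ℕ) : ℚ) / (5 ^ 11 * 7 ^ 10 * 79 * 389 ^ 2 : ℕ))) l) :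
    letI := T.instFieldF; letI := T.instNumberFieldF; letI := T.instAlgebraF; letI := T.instFieldK
    letI := T.instNumberFieldK; letI := T.instAlgebraK; letI := T.instFieldFbar; letI := T.instAlgebraFbar
    letI := T.instAlgebraKFbar; letI := T.instIsElliptic
    ∀ (M : Type) [Field M] [NumberField M]
      (archPk : ∀ (j : (thetaIndex (pilotDataOfK T.D T.K)).Label) (vQ : (thetaIndex (pilotDataOfK T.D T.K)).VQ),
        Set ((logShellsDH (pilotDataOfK T.D T.K) (analyticLogv T.K)).Packet j vQ))
      (archSub : ∀ (j : (thetaIndex (pilotDataOfK T.D T.K)).Label) (v : (thetaIndex (pilotDataOfK T.D T.K)).V),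
        Set ((logShellsDH (pilotDataOfK T.D T.K) (analyticLogv T.K)).Packet j ((thetaIndex (pilotDataOfK T.D T.K)).over v)))
      (Ψ : ℤ → ∀ v : (thetaIndex (pilotDataOfK T.D T.K)).V, v ∈ (thetaIndex (pilotDataOfK T.D T.K)).Vbad →
        Set ((logShellsDH (pilotDataOfK T.D T.K) (analyticLogv T.K)).StarPacket v))
      (act : ℤ → ∀ v : (thetaIndex (pilotDataOfK T.D T.K)).V, v ∈ (thetaIndex (pilotDataOfK T.D T.K)).Vbad →
        (logShellsDH (pilotDataOfK T.D T.K) (analyticLogv T.K)).StarPacket v →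
          Module.End ℚ ((logShellsDH (pilotDataOfK T.D T.K) (analyticLogv T.K)).StarPacket v))
      (Mmod : ℤ → ∀ j : (thetaIndex (pilotDataOfK T.D T.K)).LabelStar, Set ((logShellsDH (pilotDataOfK T.D T.K) (analyticLogv T.K)).GlobalPacket j.1))
      (region : ℤ → ∀ j : (thetaIndex (pilotDataOfK T.D T.K)).LabelStar, FinDivisor M → ∀ vQ : (thetaIndex (pilotDataOfK T.D T.K)).VQ,
        Set ((logShellsDH (pilotDataOfK T.D T.K) (analyticLogv T.K)).Packet j.1 vQ))
      (frobAdm : ℤ → ℤ → ∀ (j : (thetaIndex (pilotDataOfK T.D T.K)).Label) (vQ : (thetaIndex (pilotDataOfK T.D T.K)).VQ),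
        Set ((logShellsDH (pilotDataOfK T.D T.K) (analyticLogv T.K)).Packet j vQ) → Prop)
      (frobLogvol : ℤ → ℤ → ∀ (j : (thetaIndex (pilotDataOfK T.D T.K)).Label) (vQ : (thetaIndex (pilotDataOfK T.D T.K)).VQ),
        Set ((logShellsDH (pilotDataOfK T.D T.K) (analyticLogv T.K)).Packet j vQ) → ℝ)
      (frobΨ : ℤ → ℤ → ∀ v : (thetaIndex (pilotDataOfK T.D T.K)).V, v ∈ (thetaIndex (pilotDataOfK T.D T.K)).Vbad →
        Set ((logShellsDH (pilotDataOfK T.D T.K) (analyticLogv T.K)).StarPacket v))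
      (frobMmod : ℤ → ℤ → ∀ j : (thetaIndex (pilotDataOfK T.D T.K)).LabelStar, Set ((logShellsDH (pilotDataOfK T.D T.K) (analyticLogv T.K)).GlobalPacket j.1))
      (unitImage : ℤ → ℤ → ℕ → ∀ (j : (thetaIndex (pilotDataOfK T.D T.K)).Label) (vQ : (thetaIndex (pilotDataOfK T.D T.K)).VQ),
        Set ((logShellsDH (pilotDataOfK T.D T.K) (analyticLogv T.K)).Packet j vQ))
      (ballImage : ℤ → ℤ → ∀ (j : (thetaIndex (pilotDataOfK T.D T.K)).Label) (vQ : (thetaIndex (pilotDataOfK T.D T.K)).VQ),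
        Set ((logShellsDH (pilotDataOfK T.D T.K) (analyticLogv T.K)).Packet j vQ))
      (thetaDiv : ℤ → ℤ → LgpDivisor M (thetaIndex (pilotDataOfK T.D T.K)).lstar)
      (n : ℤ) {HT : Type} {LogLink : HT → HT → Type} {IsFull : ∀ {s t : HT}, LogLink s t → Prop}
      (lat : LGPGaussianLogThetaLattice LogLink IsFull)
      {Frd : Type} {IsoF : Frd → Frd → Type} {Ob : Frd → Type} {realify : Frd → Frd} {Strip : Type}
      {IsoS : Strip → Strip → Type} {Mv : ∀ v : (thetaIndex (pilotDataOfK T.D T.K)).V, v ∈ (thetaIndex (pilotDataOfK T.D T.K)).Vbad → Type}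
      [∀ v h, Monoid (Mv v h)]
      (sig : GlobalLGPFrobenioidSignature (thetaIndex (pilotDataOfK T.D T.K)).lstar (thetaIndex (pilotDataOfK T.D T.K)).V
        (· ∈ (thetaIndex (pilotDataOfK T.D T.K)).Vbad) Frd IsoF Ob realify Strip IsoS Mv)
      (split : SplittingMonoids Mv) {ObΔ : Type} {N : ∀ v : (thetaIndex (pilotDataOfK T.D T.K)).V, v ∈ (thetaIndex (pilotDataOfK T.D T.K)).Vbad → Type}
      [∀ v h, Monoid (N v h)] (qData : QPilotData ObΔ N)
      (qK : ∀ v : (thetaIndex (pilotDataOfK T.D T.K)).V, v ∈ (thetaIndex (pilotDataOfK T.D T.K)).Vbad →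
        Set ((logShellsDH (pilotDataOfK T.D T.K) (analyticLogv T.K)).StarPacket v)),
      ¬ Cor312Vol.PilotKummerCompatHull
          (LatticeSituation.ofShells (logShellsDH (pilotDataOfK T.D T.K) (analyticLogv T.K)) M archPk archSub
            (summandPiecesPr (pilotDataOfK T.D T.K) (logvAnalytic_analyticLogv (F := T.K))).Adm
            (summandPiecesPr (pilotDataOfK T.D T.K) (logvAnalytic_analyticLogv (F := T.K))).logvol Ψ act Mmod region frobAdm frobLogvol frobΨ
            frobMmod unitImage ballImage thetaDiv)
          (settingPrVolSharp (pilotDataOfK T.D T.K) (logvAnalytic_analyticLogv (F := T.K)) M archPk archSub Ψ act Mmod region n lat sig split qData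
            (exists_realising_qIdeles_pilotDataOfK T.D).choose (exists_realising_thetaIdeles_pilotDataOfK T.D).choose
            (exists_realising_qIdeles_pilotDataOfK T.D).choose_spec.1 (exists_realising_qIdeles_pilotDataOfK T.D).choose_spec.2.1)
          (fun _ => Cor312.Setting.qRegion
            (settingPrVolSharp (pilotDataOfK T.D T.K) (logvAnalytic_analyticLogv (F := T.K)) M archPk archSub Ψ act Mmod region n lat sig split qData
              (exists_realising_qIdeles_pilotDataOfK T.D).choose (exists_realising_thetaIdeles_pilotDataOfK T.D).choose
              (exists_realising_qIdeles_pilotDataOfK T.D).choose_spec.1 (exists_realising_qIdeles_pilotDataOfK T.D).choose_spec.2.1)) qK := by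
  have hl' := hl
  simp only [List.mem_cons, List.not_mem_nil, or_false] at hl'
  obtain ⟨hne, h3⟩ : (103 : ℕ) ≠ l ∧ 3 ≤ l := by
    rcases hl' with rfl | rfl | rfl | rfl | rfl | rfl | rfl | rfl | rfl
    all_goals norm_num
  have hfac : (11 * 103 ^ 8 * (2 ^ 45 * 3 ^ 7 * 29 * 37 * 1997) * (5 ^ 11 * 7 ^ 10 * 79 * 389 ^ 2)).factorization ((⟨103, by norm_num⟩ : Nat.Primes) : ℕ) = 8 := by
    have hp : Nat.Prime 103 := by norm_num
    have hn : 11 * 103 ^ 8 * (2 ^ 45 * 3 ^ 7 * 29 * 37 * 1997) * (5 ^ 11 * 7 ^ 10 * 79 * 389 ^ 2) = 103 ^ 8 * 299051373697918905891399922032102604800000000000 := by norm_num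
    have hm : ¬ 103 ∣ 299051373697918905891399922032102604800000000000 := by norm_num
    show (11 * 103 ^ 8 * (2 ^ 45 * 3 ^ 7 * 29 * 37 * 1997) * (5 ^ 11 * 7 ^ 10 * 79 * 389 ^ 2)).factorization 103 = 8
    rw [hn, Nat.factorization_mul (pow_ne_zero _ hp.ne_zero) (by norm_num), Finsupp.add_apply, hp.factorization_pow,
      Finsupp.single_eq_same, Nat.factorization_eq_zero_of_not_dvd hm, add_zero]
  exact GenuineK.not_pilotKummerCompatHull_chosen_triple_of_hullCells_tame isABCTriple_frey139344708952637771 T ⟨103, by norm_num⟩ (by norm_num) (by norm_num)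
    (by norm_num) hne (by norm_num) hfac (i := (l - 1) / 2 - 1) (by omega)
    (fun A hA30 hA15 hAev => RefBand.cells_139344708952637771_levels hl (by omega) A hA30 hA15 hAev)

end Summit.ABC.IUTFork.Conditional

end
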